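import Literature.Geometry.Lorentzian.AchronalBoundaryProofs
import Literature.Geometry.Lorentzian.CausalityPushUp
import Literature.Geometry.Lorentzian.CausalFutureCompactSet
import Literature.Geometry.Lorentzian.NullCornerChronology
import Literature.Topology.Euclidean.InvarianceOfDomain
import HarnessLib

/-!
# Causal curves joining two points of a closed achronal hypersurface stay in it
(Chruściel–Delay–Galloway–Howard 2001, §2; O'Neill 1983, Ch. 14, Cor. 14.27; Hawking–Ellis 1973,
Prop. 6.3.1)

For the horizons `𝓗` of Chruściel–Delay–Galloway–Howard 2001 (closed, achronal, embedded
topological hypersurfaces, "future null geodesically ruled", §2) the causal front end of the area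
theorem (§6, proof of Thm. 6.1: the map `φ` along generators, `N(p, S₂) ≥ 1`) uses that a causal
curve from a point of `𝓗` to a point of `𝓗` cannot leave `𝓗`. We prove this here
(`Spacetime.mapsTo_of_isFutureCausalCurveOn_of_isAchronal`), in three steps.

1. **Pure causality** (any achronal set `𝓢`, manifold without boundary): a future causal curve
   `γ : [a, b] → M` with `γ a, γ b ∈ 𝓢` runs in the **achronal boundary** `∂I⁺(𝓢)`
   (`IsAchronal.apply_mem_frontier_chronologicalFuture`): `γ t ∈ J⁺(𝓢) ⊆ closure I⁺(𝓢)`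
   (O'Neill Lemma 14.6 (2)), and `γ t ∈ I⁺(𝓢)` would give `γ b ∈ J⁺(I⁺(𝓢)) ⊆ I⁺(𝓢)` (push-up,
   Cor. 14.1), contradicting achronality. Also `𝓢 ⊆ ∂I⁺(𝓢)`
   (`IsAchronal.subset_frontier_chronologicalFuture`).
2. **Topology** (`IsTopologicalSubmanifold.exists_isOpen_inter_subset`): if `S₁ ⊆ S₂ ⊆ M` are
   both embedded topological `m`-submanifolds then `S₁` is open in `S₂` — Brouwer's **invariance
   of domain** (`Literature.Topology.Euclidean.Brouwer.isOpen_image_of_injOn`) applied to the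
   transition map between charts of `S₁` and `S₂`.
3. **Assembly** in a `4`-dimensional spacetime: `I⁺(𝓗)` is a future set, so `∂I⁺(𝓗)` is an
   embedded topological `3`-submanifold (Hawking–Ellis 1973, Prop. 6.3.1, the tree's
   `HawkingEllis1973_achronalBoundary_holds`); `𝓗 ⊆ ∂I⁺(𝓗)` is closed and, by step 2, open in
   `∂I⁺(𝓗)`; the connected set `γ([a, b]) ⊆ ∂I⁺(𝓗)` meets `𝓗`, hence lies in `𝓗` (continuous
   induction on `[a, b]`).

Everything is proved; no definitions and no named facts are introduced (D-0026). Layer L0 (ii)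
of the programme for `ChruscielEtAl2001_areaTheorem`.

## References

* P. T. Chruściel, E. Delay, G. J. Galloway, R. Howard, *Regularity of horizons and the area
  theorem*, Ann. Henri Poincaré 2 (2001) 109–178, §2 (horizons), §6 (proof of Thm. 6.1).
  [ChruscielEtAl2001]
* B. O'Neill, *Semi-Riemannian geometry with applications to relativity*, Academic Press 1983,
  Ch. 14, Cor. 14.1, Lemma 14.6, Cor. 14.27 (pp. 402–415). [ONeillSemiRiemannian1983]
* S. W. Hawking, G. F. R. Ellis, *The large scale structure of space-time*, CUP 1973,
  Prop. 6.3.1 (p. 187). [HawkingEllis1973]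
* T. Tao, *Hilbert's fifth problem and related topics*, AMS 2014, Thm. 6.0.12 (invariance of
  domain). [Tao2014]
-/

noncomputable section

universe u

open Bundle Set Filter Function Topology
open scoped Manifold ContDiff Topology

namespace Literature.Geometry.Lorentzian

/-! ### Step 2: a submanifold inside a submanifold of the same dimension is open in it -/

/-- **Invariance of domain for embedded topological submanifolds.** If `S₁ ⊆ S₂ ⊆ M` are both
embedded topological `m`-submanifolds (`IsTopologicalSubmanifold`, `EventHorizonArea.lean`), then
`S₁` is open in `S₂`: every `p ∈ S₁` has an open `U ∋ p` in `M` with `U ∩ S₂ ⊆ S₁`. Proof: read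
the inclusion `S₁ ↪ S₂` in Euclidean charts of `S₁` at `p` and of `S₂` at `p`; the transition map
is a continuous injection between open subsets of `ℝᵐ`, hence open by Brouwer's invariance of
domain (`Literature.Topology.Euclidean.Brouwer.isOpen_image_of_injOn`; Tao 2014, Thm. 6.0.12).
[cite: Tao2014, Thm. 6.0.12] -/
theorem IsTopologicalSubmanifold.exists_isOpen_inter_subset {M : Type*} [TopologicalSpace M]
    {m : ℕ} {S₁ S₂ : Set M} (h₁ : IsTopologicalSubmanifold m S₁)
    (h₂ : IsTopologicalSubmanifold m S₂) (hsub : S₁ ⊆ S₂) {p : M} (hp : p ∈ S₁) :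
    ∃ U : Set M, IsOpen U ∧ p ∈ U ∧ U ∩ S₂ ⊆ S₁ := by
  classical
  obtain ⟨V₁, hV₁o, hpV₁, W₁, hW₁o, ⟨φ₁⟩⟩ := h₁ ⟨p, hp⟩
  obtain ⟨V₂, hV₂o, hpV₂, W₂, hW₂o, ⟨φ₂⟩⟩ := h₂ ⟨p, hsub hp⟩
  set ι : S₁ → S₂ := Set.inclusion hsub with hι
  have hιc : Continuous ι := continuous_inclusion hsub
  have hιi : Injective ι := Set.inclusion_injective hsub
  -- Euclidean charts as open embeddings into `ℝᵐ`
  set e₁ : V₁ → EuclideanSpace ℝ (Fin m) := fun x ↦ (φ₁ x : EuclideanSpace ℝ (Fin m)) with he₁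
  set e₂ : V₂ → EuclideanSpace ℝ (Fin m) := fun y ↦ (φ₂ y : EuclideanSpace ℝ (Fin m)) with he₂
  have hE₁ : IsOpenEmbedding e₁ := hW₁o.isOpenEmbedding_subtypeVal.comp φ₁.isOpenEmbedding
  have hE₂ : IsOpenEmbedding e₂ := hW₂o.isOpenEmbedding_subtypeVal.comp φ₂.isOpenEmbedding
  haveI : Nonempty V₁ := ⟨⟨⟨p, hp⟩, hpV₁⟩⟩
  -- the open set `O ⊆ V₁` of points mapped into `V₂`
  set O : Set V₁ := {x | ι (x : S₁) ∈ V₂} with hO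
  have hOo : IsOpen O := (hV₂o.preimage hιc).preimage continuous_subtype_val
  have hpO : (⟨⟨p, hp⟩, hpV₁⟩ : V₁) ∈ O := hpV₂
  set A : Set (EuclideanSpace ℝ (Fin m)) := e₁ '' O with hA
  have hAo : IsOpen A := hE₁.isOpenMap O hOo
  -- the transition map `f = e₂ ∘ ι ∘ e₁⁻¹` on `A`
  set j : V₁ → EuclideanSpace ℝ (Fin m) := fun x ↦
    if h : ι (x : S₁) ∈ V₂ then e₂ ⟨ι x, h⟩ else 0 with hj
  have hjc : ContinuousOn j O := by
    rw [continuousOn_iff_continuous_restrict]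
    have heq : O.restrict j = fun x : O ↦ e₂ ⟨ι (x : V₁), x.2⟩ := by
      funext x
      have hx : ι ((x : V₁) : S₁) ∈ V₂ := x.2
      simp only [restrict_apply, hj]
      rw [dif_pos hx]
    rw [heq]
    exact hE₂.continuous.comp (Continuous.subtype_mk
      (hιc.comp (continuous_subtype_val.comp continuous_subtype_val)) _)
  set Φ := hE₁.toOpenPartialHomeomorph e₁ with hΦ
  have hΦsymm : ∀ x : V₁, Φ.symm (e₁ x) = x := fun x ↦ hE₁.toOpenPartialHomeomorph_left_inv
  have hΦt : Φ.target = range e₁ := hE₁.toOpenPartialHomeomorph_target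
  set f : EuclideanSpace ℝ (Fin m) → EuclideanSpace ℝ (Fin m) := fun z ↦ j (Φ.symm z) with hf
  have hfc : ContinuousOn f A := by
    refine hjc.comp (Φ.continuousOn_symm.mono ?_) ?_
    · rintro _ ⟨x, -, rfl⟩
      rw [hΦt]; exact mem_range_self x
    · rintro _ ⟨x, hx, rfl⟩
      show Φ.symm (e₁ x) ∈ O
      rw [hΦsymm]; exact hx
  have hfval : ∀ (x : V₁) (hx : x ∈ O), f (e₁ x) = e₂ ⟨ι x, hx⟩ := by
    intro x hx
    have hx' : ι (x : S₁) ∈ V₂ := hx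
    show j (Φ.symm (e₁ x)) = _
    rw [hΦsymm]
    simp only [hj]
    rw [dif_pos hx']
  have hfi : InjOn f A := by
    rintro _ ⟨x, hx, rfl⟩ _ ⟨x', hx', rfl⟩ h
    rw [hfval x hx, hfval x' hx'] at h
    have h1 := hE₂.injective h
    have h2 : ι (x : S₁) = ι x' := congrArg Subtype.val h1
    have h3 : (x : S₁) = x' := hιi h2
    rw [Subtype.ext h3]
  -- invariance of domain
  have hopen : IsOpen (f '' A) :=
    Literature.Topology.Euclidean.Brouwer.isOpen_image_of_injOn rfl hAo hfc hfi
  -- `f '' A = e₂ '' B` with `B` the trace of `ι '' O` on `V₂`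
  set B : Set V₂ := {y | ∃ x ∈ O, ι (x : S₁) = (y : S₂)} with hB
  have hfA : f '' A = e₂ '' B := by
    apply Subset.antisymm
    · rintro _ ⟨_, ⟨x, hx, rfl⟩, rfl⟩
      rw [hfval x hx]
      exact ⟨⟨ι x, hx⟩, ⟨x, hx, rfl⟩, rfl⟩
    · rintro _ ⟨y, ⟨x, hx, hxy⟩, rfl⟩
      refine ⟨e₁ x, ⟨x, hx, rfl⟩, ?_⟩
      rw [hfval x hx]
      congr 1
      exact Subtype.ext hxy
  have hBo : IsOpen B := by
    rw [hE₂.isOpen_iff_image_isOpen, ← hfA]; exact hopen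
  -- `val '' B` is open in `S₂`, contained in `S₁`, and contains `p`
  have hBo' : IsOpen ((Subtype.val : V₂ → S₂) '' B) := hV₂o.isOpenMap_subtype_val B hBo
  obtain ⟨U, hUo, hU⟩ := isOpen_induced_iff.1 hBo'
  refine ⟨U, hUo, ?_, ?_⟩
  · have : (⟨p, hsub hp⟩ : S₂) ∈ (Subtype.val : V₂ → S₂) '' B :=
      ⟨⟨⟨p, hsub hp⟩, hpV₂⟩, ⟨⟨⟨p, hp⟩, hpV₁⟩, hpO, rfl⟩, rfl⟩
    rw [← hU] at this
    exact this
  · rintro z ⟨hzU, hzS₂⟩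
    have hz : (⟨z, hzS₂⟩ : S₂) ∈ Subtype.val ⁻¹' U := hzU
    rw [hU] at hz
    obtain ⟨y, ⟨x, -, hxy⟩, hyz⟩ := hz
    have : (ι (x : S₁) : M) = z := by
      rw [hxy]
      exact congrArg Subtype.val hyz
    rw [← this]
    exact (x : S₁).2

/-! ### Step 1: causal curves between points of an achronal set run in `∂I⁺` -/

section Causal

variable {E : Type*} [NormedAddCommGroup E] [NormedSpace ℝ E] {H : Type*} [TopologicalSpace H]
  {I : ModelWithCorners ℝ E H} {M : Type*} [TopologicalSpace M] [ChartedSpace H M]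
  [IsManifold I ∞ M] {n : ℕ∞ω} {g : LorentzianMetric I n M} (τ : TimeOrientation g)

/-- **Points of an achronal set lie in the frontier of its chronological future**: for `p ∈ 𝓢`
there are points `q ≫ p` arbitrarily close to `p` (along the orienting field), and `p ∉ I⁺(𝓢)` by
achronality. O'Neill 1983, Ch. 14, p. 413 (achronal sets and their `I^±`). [cite: ONeillSemiRiemannian1983, Ch. 14, p. 413] -/
theorem _root_.Literature.Geometry.Lorentzian.LorentzianMetric.IsAchronal.subset_frontier_chronologicalFuture
    [BoundarylessManifold I M] [CompleteSpace E] (hn : 1 ≤ n) {𝓢 : Set M}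
    (h𝓢 : g.IsAchronal τ 𝓢) : 𝓢 ⊆ frontier (g.chronologicalFuture τ 𝓢) := by
  intro p hp
  have hnot : p ∉ g.chronologicalFuture τ 𝓢 := by
    rintro ⟨h, hh, γ, a, b, hab, hγ, hγa, hγb⟩
    exact h𝓢 h hh p hp ⟨h, mem_singleton _, γ, a, b, hab, hγ, hγa, hγb⟩
  have hcl : p ∈ closure (g.chronologicalFuture τ 𝓢) := by
    rw [mem_closure_iff_nhds]
    intro O hO
    obtain ⟨k, hkO, hk⟩ :=
      LorentzianMetric.exists_mem_nhds_mem_chronologicalFuture (τ := τ.reverse) hn hO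
    -- `p ∈ I⁺_{reverse}(k)` means `k ∈ I⁺(p)`
    have hk' : k ∈ g.chronologicalFuture τ {p} :=
      LorentzianMetric.mem_chronologicalFuture_of_mem_chronologicalPast hk
    exact ⟨k, hkO, LorentzianMetric.chronologicalFuture_mono (singleton_subset_iff.2 hp) hk'⟩
  exact ⟨hcl, by rwa [(LorentzianMetric.isOpen_chronologicalFuture_of_boundaryless g τ 𝓢).interior_eq]⟩

/-- **A causal curve joining two points of an achronal set runs in the achronal boundary
`∂I⁺(𝓢)` and never enters `I⁺(𝓢)`** (O'Neill 1983, Ch. 14: Lemma 14.6 (2) `J⁺ ⊆ closure I⁺`,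
Cor. 14.1 push-up, p. 413 achronality; the causal input of Chruściel–Delay–Galloway–Howard 2001,
§6). For `𝓢` achronal and `γ` future causal on `[a, b]` with `γ a, γ b ∈ 𝓢`: every `γ t`,
`t ∈ [a, b]`, lies in `frontier (I⁺(𝓢))` and not in `I⁺(𝓢)`.
[cite: ONeillSemiRiemannian1983, Ch. 14, Lemma 14.6 (2) and Cor. 14.1 (pp. 402–404)] -/
theorem _root_.Literature.Geometry.Lorentzian.LorentzianMetric.IsAchronal.apply_mem_frontier_chronologicalFuture
    [BoundarylessManifold I M] [FiniteDimensional ℝ E] (hn : 1 ≤ n) {𝓢 : Set M}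
    (h𝓢 : g.IsAchronal τ 𝓢) {γ : ℝ → M} {a b : ℝ} (hγ : g.IsFutureCausalCurveOn τ γ (Icc a b))
    (ha : γ a ∈ 𝓢) (hb : γ b ∈ 𝓢) {t : ℝ} (ht : t ∈ Icc a b) :
    γ t ∈ frontier (g.chronologicalFuture τ 𝓢) ∧ γ t ∉ g.chronologicalFuture τ 𝓢 := by
  -- `γ t ∈ J⁺(𝓢)` along `γ|[a, t]`, and `γ b ∈ J⁺(γ t)` along `γ|[t, b]`
  have hJ : γ t ∈ g.causalFuture τ 𝓢 := by
    have h1 : γ t ∈ g.causalFuture τ {γ a} := by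
      rcases eq_or_lt_of_le ht.1 with h | h
      · rw [← h]; exact LorentzianMetric.subset_causalFuture g τ {γ a} (mem_singleton _)
      · exact Or.inr ⟨γ a, mem_singleton _, γ, a, t, h,
          hγ.mono (Icc_subset_Icc le_rfl ht.2), rfl, rfl⟩
    exact LorentzianMetric.causalFuture_mono (singleton_subset_iff.2 ha) h1
  have hJ2 : γ b ∈ g.causalFuture τ {γ t} := by
    rcases eq_or_lt_of_le ht.2 with h | h
    · rw [h]; exact LorentzianMetric.subset_causalFuture g τ {γ b} (mem_singleton _)
    · exact Or.inr ⟨γ t, mem_singleton _, γ, t, b, h,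
        hγ.mono (Icc_subset_Icc ht.1 le_rfl), rfl, rfl⟩
  have hcl : γ t ∈ closure (g.chronologicalFuture τ 𝓢) :=
    LorentzianMetric.causalFuture_subset_closure_chronologicalFuture_of_boundaryless hn 𝓢 hJ
  have hnot : γ t ∉ g.chronologicalFuture τ 𝓢 := by
    rintro ⟨h, hh, β, a', b', hab', hβ, hβa, hβb⟩
    have h1 : γ t ∈ g.chronologicalFuture τ {h} := ⟨h, mem_singleton _, β, a', b', hab', hβ, hβa, hβb⟩
    -- push-up (time dual): `γ b ∈ J⁺(γ t)` and `γ t ∈ I⁺(h)` give `γ b ∈ I⁺(h)`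
    have h2 : γ t ∈ g.causalFuture τ.reverse {γ b} :=
      LorentzianMetric.mem_causalFuture_reverse_of_mem_causalFuture hJ2
    have h3 : h ∈ g.chronologicalFuture τ.reverse {γ t} :=
      LorentzianMetric.mem_chronologicalPast_of_mem_chronologicalFuture h1
    have h4 : h ∈ g.chronologicalFuture τ.reverse {γ b} :=
      LorentzianMetric.mem_chronologicalFuture_of_mem_causalFuture hn h2 h3
    have h5 : γ b ∈ g.chronologicalFuture τ {h} :=
      LorentzianMetric.mem_chronologicalFuture_of_mem_chronologicalPast h4
    exact h𝓢 h hh (γ b) hb h5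
  exact ⟨⟨hcl, by rwa [(LorentzianMetric.isOpen_chronologicalFuture_of_boundaryless g τ 𝓢).interior_eq]⟩,
    hnot⟩

/-- `I⁺(𝓢)` is a future set: `I⁺(I⁺(𝓢)) ⊆ I⁺(𝓢)` (transitivity of `≪`). Hawking–Ellis 1973,
§6.3, p. 186. [cite: HawkingEllis1973, §6.3, p. 186] -/
theorem _root_.Literature.Geometry.Lorentzian.LorentzianMetric.isFutureSet_chronologicalFuture
    (𝓢 : Set M) : g.IsFutureSet τ (g.chronologicalFuture τ 𝓢) := by
  rintro q ⟨p, hp, γ, a, b, hab, hγ, hγa, hγb⟩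
  exact LorentzianMetric.mem_chronologicalFuture_trans hp ⟨p, mem_singleton _, γ, a, b, hab, hγ, hγa, hγb⟩

end Causal

/-! ### Step 3: closed achronal hypersurfaces of a spacetime -/

namespace Spacetime

variable (𝓢 : Spacetime.{u} 4)

/-- **A causal curve from a point of a closed achronal topological hypersurface `𝓗` to a point
of `𝓗` lies in `𝓗`** (Chruściel–Delay–Galloway–Howard 2001, §2/§6 for the horizons of the area
theorem; O'Neill 1983, Ch. 14, Cor. 14.27 and Prop. 10.46 for the classical statement that such
a curve is a null geodesic in `𝓗`). In a `4`-dimensional spacetime, for `𝓗` closed, achronal and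
an embedded topological `3`-submanifold, every future causal curve `γ` on `[a, b]` with
`γ a, γ b ∈ 𝓗` has `γ([a, b]) ⊆ 𝓗`. See the module docstring for the proof.
[cite: ChruscielEtAl2001, §2 and §6 (proof of Thm. 6.1)] -/
theorem mapsTo_of_isFutureCausalCurveOn_of_isAchronal {𝓗 : Set 𝓢.carrier} (hcl : IsClosed 𝓗)
    (h𝓗 : 𝓢.metric.IsAchronal 𝓢.timeOrientation 𝓗) (htop : IsTopologicalSubmanifold 3 𝓗)
    {γ : ℝ → 𝓢.carrier} {a b : ℝ}
    (hγ : 𝓢.metric.IsFutureCausalCurveOn 𝓢.timeOrientation γ (Icc a b))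
    (ha : γ a ∈ 𝓗) (hb : γ b ∈ 𝓗) : MapsTo γ (Icc a b) 𝓗 := by
  set g := 𝓢.metric with hg
  set τ := 𝓢.timeOrientation with hτ
  have hn : (1 : ℕ∞ω) ≤ ∞ := by exact_mod_cast le_top
  -- the achronal boundary `∂I⁺(𝓗)`
  set F : Set 𝓢.carrier := frontier (g.chronologicalFuture τ 𝓗) with hF
  obtain ⟨-, -, hFtop⟩ := HawkingEllis1973_achronalBoundary_holds 𝓢 (g.chronologicalFuture τ 𝓗)
    (LorentzianMetric.isFutureSet_chronologicalFuture τ 𝓗)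
  have hsubF : 𝓗 ⊆ F := LorentzianMetric.IsAchronal.subset_frontier_chronologicalFuture τ hn h𝓗
  have hγF : ∀ t ∈ Icc a b, γ t ∈ F := fun t ht ↦
    (LorentzianMetric.IsAchronal.apply_mem_frontier_chronologicalFuture τ hn h𝓗 hγ ha hb ht).1
  -- `𝓗` is open in `F`
  have hopen : ∀ p ∈ 𝓗, ∃ U : Set 𝓢.carrier, IsOpen U ∧ p ∈ U ∧ U ∩ F ⊆ 𝓗 := fun p hp ↦
    IsTopologicalSubmanifold.exists_isOpen_inter_subset htop hFtop hsubF hp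
  -- continuous induction on `[a, b]`
  have hγc : ∀ t ∈ Icc a b, ContinuousAt γ t := fun t ht ↦ (hγ t ht).1.continuousAt
  set A : Set ℝ := {t | γ t ∈ 𝓗} with hA
  suffices h : Icc a b ⊆ A from fun t ht ↦ h ht
  refine IsClosed.Icc_subset_of_forall_mem_nhdsWithin ?_ ha ?_
  · -- closedness of `A ∩ [a, b]`
    have hcont : ContinuousOn γ (Icc a b) := fun t ht ↦ (hγc t ht).continuousWithinAt
    have h := hcont.preimage_isClosed_of_isClosed isClosed_Icc hcl
    rwa [inter_comm] at h
  · rintro t ⟨htA, hta, htb⟩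
    obtain ⟨U, hUo, htU, hU⟩ := hopen (γ t) htA
    have hev : ∀ᶠ s in 𝓝 t, γ s ∈ U := (hγc t ⟨hta, htb.le⟩).preimage_mem_nhds (hUo.mem_nhds htU)
    have hev' : ∀ᶠ s in 𝓝[>] t, s ∈ Ioo t b := Ioo_mem_nhdsGT htb
    filter_upwards [hev.filter_mono nhdsWithin_le_nhds, hev'] with s hs hs'
    exact hU ⟨hs, hγF s ⟨hta.trans hs'.1.le, hs'.2.le⟩⟩

end Spacetime

end Literature.Geometry.Lorentzian
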